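import Summits.NavierStokesRegularity.FluidComputer.PalasekTowerEpisodes

/-!
# Stages of one schedule are unique (given the forced uniqueness `hU`); margin-monotone restriction

Cell `ns-blowup`, seat `ns-blowup-lean` (g2); companion of `PalasekTowerEpisodes.lean`. LABEL: E–C
typing (KERNEL bookkeeping). WHAT THIS IS NOT: not Navier–Stokes evidence — two structural facts
about the typed objects `Schedule` / `Stage` / `Margins`, used by the refuter's SURGERY CENSUS
(K35, STATUS l.1064: "hU compares solutions with the SAME force") and by depth rungs:

* `Stage.velocity_eq_of_le` — given Tao's unconditional uniqueness with its force slot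
  (`tao_unconditional_uniqueness_velocity_forced`, the route's hypothesis `hU`) and `ν > 0`, two
  stages of the SAME schedule at levels `k ≤ k'` have the same velocity on the common slab
  `[0, τ_k]`: both are classical solutions there of the same forced system from the same Clay datum
  with finite energy, and the datum is `H¹` (`ClayUniqueness.memLp_two_of_rapidDecay`). So a
  schedule carries at most ONE flow; K2R's `∃ s', s.Extends s'` says "THE flow continues and meets
  level `k+1`" (pressure up to its time-dependent gauge), and two instances of a `∀`-schedule
  induction on one schedule cannot disagree — the hU-consistency door is shut at the level of
  velocities (planner l.999 MORAL; refuter K35 §1).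
* `Stage.restrictOfAntitone` — if the margin is antitone in the level (every clause accumulated up
  to `k'` implies the clauses up to `k ≤ k'`; true for `⊤`, `Margins.withStrain` of an antitone
  margin, the register), a stage at level `k'` restricts to a stage at level `k` (same flow on the
  shorter closed slab).

References: T. Tao, Anal. PDE 6 (2013), Cor. 11.4 [cite: Tao2011, Cor. 11.4]; S. Palasek,
arXiv:2605.13827 §4 [cite: Palasek2026ElementaryModel, §4].
-/

noncomputable section

namespace Summit.NavierStokesRegularity.FluidComputer.PalasekTowerClayBridge

open Set MeasureTheory Filter Topology Function
open scoped ENNReal ContDiff NNReal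
open Literature.Analysis.FluidPDE
open Summit.NavierStokesRegularity.NavierStokesRegularity

namespace Stage

variable {ν : ℝ} {R : TowerRates} {S : Schedule R} {m m' : Margins R} {k k' : ℕ}

/-- The datum of any stage is smooth (slice `t = 0` of a classical solution). [folklore] -/
theorem contDiff_datum (s : Stage ν R S m k) : ContDiff ℝ ∞ S.u₀ := by
  rw [← s.initial]
  exact s.classical.contDiff_velocity (t := 0) ⟨le_rfl, (S.τ_pos k).le⟩

/-- A stage restricted to a shorter closed slab `[0, τ_j]`, `j ≤ k`, is still a classical solution
there. [folklore] -/
theorem classical_of_le (s : Stage ν R S m k) {j : ℕ} (hj : j ≤ k) :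
    IsClassicalNSSolutionOn (Icc 0 (S.τ j)) ν S.f s.u s.p :=
  s.classical.mono (Icc_subset_Icc le_rfl (S.τ_mono hj)) (uniqueDiffOn_Icc (S.τ_pos j))

/-- **Stages of one schedule share their velocity (given `hU`).** Two stages of the same schedule at
levels `k ≤ k'` — for possibly different margins — have the same velocity on `[0, τ_k]`.
[cite: Tao2011, Cor. 11.4] -/
theorem velocity_eq_of_le (hU : tao_unconditional_uniqueness_velocity_forced) (hν : 0 < ν)
    (hk : k ≤ k') (s : Stage ν R S m k) (s' : Stage ν R S m' k') :
    ∀ t ∈ Icc 0 (S.τ k), s'.u t = s.u t := by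
  have hτ : 0 < S.τ k := S.τ_pos k
  have hcl : IsClassicalNSSolutionOn (Icc 0 (S.τ k)) ν S.f s.u s.p := s.classical
  have hcl' : IsClassicalNSSolutionOn (Icc 0 (S.τ k)) ν S.f s'.u s'.p := s'.classical_of_le hk
  have hC1 : ContDiff ℝ 1 S.u₀ := s.contDiff_datum.of_le (by norm_cast)
  obtain ⟨hL2, hH1⟩ := Theorems.ClayUniqueness.memLp_two_of_rapidDecay S.datum_decay hC1
  have hE : ∃ C : ℝ≥0∞, C < ⊤ ∧ ∀ t ∈ Icc 0 (S.τ k), ∫⁻ x, ‖s.u t x‖ₑ ^ 2 ≤ C := s.energy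
  have hE' : ∃ C : ℝ≥0∞, C < ⊤ ∧ ∀ t ∈ Icc 0 (S.τ k), ∫⁻ x, ‖s'.u t x‖ₑ ^ 2 ≤ C := by
    obtain ⟨C, hC, hb⟩ := s'.energy
    exact ⟨C, hC, fun t ht => hb t ⟨ht.1, ht.2.trans (S.τ_mono hk)⟩⟩
  intro t ht
  exact hU ν (S.τ k) hν hτ S.u₀ hL2 hH1 S.f S.force_smooth S.force_decay s'.u s.u s'.p s.p hcl' hcl
    s'.initial s.initial hE' hE t ht

/-- Same level, any two margins: the velocities coincide on the whole slab. [cite: Tao2011, Cor. 11.4] -/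
theorem velocity_eq (hU : tao_unconditional_uniqueness_velocity_forced) (hν : 0 < ν)
    (s : Stage ν R S m k) (s' : Stage ν R S m' k) : ∀ t ∈ Icc 0 (S.τ k), s'.u t = s.u t :=
  velocity_eq_of_le hU hν le_rfl s s'

/-- Consequence for the induction step: an extension in the sense of `Stage.Extends` is, on the
velocity, automatic — any stage at level `k+1` of the same schedule already agrees with `s` on
`[0, τ_k]` (given `hU`); only the pressure gauge is constrained by `Extends`. [cite: Tao2011, Cor. 11.4] -/
theorem velocity_extends (hU : tao_unconditional_uniqueness_velocity_forced) (hν : 0 < ν)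
    (s : Stage ν R S m k) (s' : Stage ν R S m' (k + 1)) :
    ∀ t ∈ Icc 0 (S.τ k), s'.u t = s.u t :=
  velocity_eq_of_le hU hν (Nat.le_succ k) s s'

end Stage

/-! ## Margin-antitone restriction -/

/-- A margin is ANTITONE IN THE LEVEL if its clauses at level `k'` imply its clauses at every
`k ≤ k'` for the same schedule and velocity (the margin only accumulates readout clauses). [folklore] -/
def Margins.Antitone {R : TowerRates} (m : Margins R) : Prop :=
  ∀ (S : Schedule R) (k k' : ℕ) (u : ℝ → EuclideanSpace ℝ (Fin 3) → EuclideanSpace ℝ (Fin 3)),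
    k ≤ k' → m S k' u → m S k u

/-- The trivial margin is antitone. [folklore] -/
theorem Margins.antitone_top {R : TowerRates} : Margins.Antitone (R := R) (fun _ _ _ => True) :=
  fun _ _ _ _ _ _ => trivial

namespace Stage

variable {ν : ℝ} {R : TowerRates} {S : Schedule R} {m : Margins R} {k k' : ℕ}

/-- **Restriction of a stage to a lower level** for a level-antitone margin: same velocity and
pressure, read on the shorter closed slab. [folklore] -/
def restrictOfAntitone (hm : Margins.Antitone m) (hk : k ≤ k') (s : Stage ν R S m k') :
    Stage ν R S m k where
  u := s.u
  p := s.p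
  classical := s.classical_of_le hk
  initial := s.initial
  energy := by
    obtain ⟨C, hC, hb⟩ := s.energy
    exact ⟨C, hC, fun t ht => hb t ⟨ht.1, ht.2.trans (S.τ_mono hk)⟩⟩
  floor := fun j hj => s.floor j (hj.trans hk)
  ceiling := fun j hj => s.ceiling j (hj.trans hk)
  quiet := fun j hj => s.quiet j (hj.trans hk)
  margin := hm S k k' s.u hk s.margin

/-- The restriction extends back: `(restrict s).Extends`-compatibility — the restricted stage and
the original agree on the shorter slab (by `rfl`). [folklore] -/
theorem restrictOfAntitone_u (hm : Margins.Antitone m) (hk : k ≤ k') (s : Stage ν R S m k') :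
    (s.restrictOfAntitone hm hk).u = s.u :=
  rfl

/-- A stage at level `k+1` extends its own restriction to level `k`. [folklore] -/
theorem restrictOfAntitone_extends (hm : Margins.Antitone m) (s : Stage ν R S m (k + 1)) :
    (s.restrictOfAntitone hm (Nat.le_succ k)).Extends s :=
  fun _ _ => ⟨rfl, rfl⟩

end Stage

end Summit.NavierStokesRegularity.FluidComputer.PalasekTowerClayBridge

end
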